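import Summits.BirchSwinnertonDyer.BirchSwinnertonDyer.Theorems.BiquadraticEisensteinDescentHeegnerTwistCouplingInSupplySqrtSevenLocal
import Summits.BirchSwinnertonDyer.BirchSwinnertonDyer.Theorems.GoldfeldAllTwistsTwoConverseTwinInertSevenPartnerRank
import Literature.NumberTheory.EllipticCurves.TwoIsogenyShaTwoTorsion
import Literature.NumberTheory.EllipticCurves.SelmerCorankHolds
import HarnessLib

set_option linter.dupNamespace false -- `Summit.BirchSwinnertonDyer.BirchSwinnertonDyer.Theorems.…` (summit = sub)
set_option autoImplicit false

/-!
# Crux `HeegnerTwistCouplingInSupply` (stmt-BirchSwinnertonDyer-21381) — the `j = −3375` family, CELL-√7 PROVED: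
# the complete `2`-isogeny descent of `A_n : y² = x³ + 21n x² + 112n² x` (`= X₀(49)^{(n)}`, CM by `ℤ[(1+√−7)/2]`) for
# `n = q·m`, `q ≡ 3 (mod 8)` a prime inert in `ℚ(√−7)`, `m ≥ 1` square-free with every prime factor `≡ 1 (mod 4)` and
# inert in `ℚ(√−7)`: `S ⊆ {1, 7}`, `S′ ⊆ {1, −7}`, `rank A_n(ℚ) = 0`, `Ш(A_n/ℚ)[2] = 0`, `corank_{ℤ₂} Sel_{2^∞}(A_n/ℚ) = 0`
# — UNCONDITIONAL (no named fact)

Route `BiquadraticEisensteinDescent` (cell `pub/bsd-wall`, width seat `bsd-wall-cm-bed-w1` g11; `--supports` 21381, helper). A third CM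
family for the corner layer of the crux (after `j = 1728` — `E_p`, `E_{2p}`, the quartic twists — and `j = 8000` — `B_p`, `B_{−2p}`): the
quadratic twists `A_n = ⟨0, 21n, 0, 112n², 0⟩` of `A = X₀(49) = 49a1` (`(a, b) = (21, 112)`, `a² − 4b = −7`; the two-torsion model
`⟨(2)⁻¹, 2n, 0, 0⟩ • cm7^{(n)}` of the tree, `GoldfeldGoodTwists.twoTorsionModel_eq_smul_quadraticTwist`). The engine is the tree's PROVED
descent via two-isogeny (`twoIsogenySelmerGroup`, `two_pow_twoIsogenySelmerRank_add_eq`, `forall_mem_sha_two_smul_eq_zero_of_halfModel`,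
AEC X.4.9 / X.4.2(a) / III.6.1) and the local lemmas of the `bsd-goldfeld` cell (`not_isSoluble_padic_of_prime_dvd_coeffs`,
`not_isSoluble_padic_of_nonresidue_of_sq_dvd`, `not_isSoluble_padic_of_nonresidue_of_prime_dvd`, `not_isSoluble_two_of_zmodPow`,
`not_isSoluble_real_twoIsogenyQuartic_of_neg_of_sq_lt`), which treated the NEGATIVE twists `49a1^{(−m)}` (rank `≤ 1`); here the
POSITIVE twists with ONE prime factor `q ≡ 3 (mod 8)`:

* (symbols, `2`-adic residues and `r`-adic deaths: part I `…SqrtSevenLocal`);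
* §3 ★ `mem_twoIsogenySelmerGroup_phiHat` — **`S(21n, 112n²) ⊆ {1, 7}`**: `d < 0` dies over `ℝ` (`441n² < 448n²`), a class through a prime
  `r ∣ n` dies at `r` (reduced discriminant `−7(n/r)²`, `(−7/r) = −1` for every prime of the cell), `2`, `14` die at `q`
  (`(2/q) = (14/q) = −1`, `q² ∣ 56n², 8n²`); ★ `mem_twoIsogenySelmerGroup_phi` — **`S(−42n, −7n²) ⊆ {1, −7}`**: a class through `r ∣ m`
  dies at `r` (`1792(n/r)² = 7·□`, `(7/r) = −1`), `−1, 7, q, −7q` die at `7` (`(−1/7) = (q/7) = −1`, `7 ∥ 7n²`), `−q, 7q` die at `2`;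
* §4 ★ `rank_eq_zero_and_sha_two` (**`rank A_n(ℚ) = 0 ∧ Ш(A_n/ℚ)[2] = 0`**, via the Goldfeld cell's `rank_eq_zero_and_sha_two_of_card_le_two`),
  ★ `selmerCorank_two_eq_zero` (**`corank_{ℤ₂} Sel_{2^∞} = 0`**).

Numerics (seat folder `work/explore4.py`, exact local solubility, `n ≤ 1200`): sharp (`S = {1,7}`, `S′ = {1,−7}`) in `100 %` of the cell and
of its `m`-only sub-cell; a prime factor `≡ 7 (mod 8)` or a second factor `≡ 3 (mod 8)` breaks it. Nearest print: Coates–Li–Tian–Zhai 2015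
Thm. 1.2 (`L(A^{(R)}, 1) ≠ 0` for `R` a product of primes `≡ 1 (mod 4)` inert in `ℚ(√−7)` — the `q`-free sub-cell; the factor `q` is new here).
HONEST FRAMING: unconditional arithmetic of one explicit CM family; nothing about `L`-values (the sequel `…SqrtSevenCorner` adds Burungale–Tian +
Deuring–Hecke); the crux (all CM `W` of analytic rank one; residual C⁺) and BSD are NOT proved by any of this. THEOREMS ONLY.
-/

noncomputable section

open scoped Classical

namespace Summit.BirchSwinnertonDyer.BirchSwinnertonDyer.Theorems.BiquadraticEisensteinDescentHeegnerTwistCouplingInSupplySqrtSevenCell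

open _root_.WeierstrassCurve Literature.NumberTheory.EllipticCurves
open Summit.BirchSwinnertonDyer.BirchSwinnertonDyer.Theorems.GoldfeldGoodTwists
  (not_isSoluble_real_twoIsogenyQuartic_of_neg_of_sq_lt not_isSoluble_padic_of_nonresidue_of_prime_dvd
    not_isSoluble_padic_of_nonresidue_of_sq_dvd mordellWeilRank_congr forall_mem_sha_two_congr
    hab_posTwist rank_eq_zero_and_sha_two_of_card_le_two)
open Summit.BirchSwinnertonDyer.BirchSwinnertonDyer.Theorems.BiquadraticEisensteinDescentHeegnerTwistCouplingInSupplySqrtSevenLocal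
open Summit.BirchSwinnertonDyer.BirchSwinnertonDyer.Theorems.BiquadraticEisensteinDescentHeegnerTwistCouplingInSupplyQuarticTwistDescentDual
  (not_isSquare_two_mod_q)

/-! ## §3 The two Selmer sets of `A_n`, `n = q m`: `S(21n, 112n²) ⊆ {1, 7}` and `S(−42n, −7n²) ⊆ {1, −7}` -/

section Selmer

variable {q m : ℕ}

/-- `S′(21n, 112n²) = S(−42n, −7n²)` (`−2a = −42n`, `a² − 4b = 441n² − 448n² = −7n²`). [folklore] -/
theorem twoIsogenySelmerGroup'_A (n : ℤ) :
    twoIsogenySelmerGroup' (21 * n) (112 * n ^ 2) = twoIsogenySelmerGroup (-42 * n) (-7 * n ^ 2) := by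
  rw [twoIsogenySelmerGroup'_eq]
  congr 1 <;> ring

variable (hq : q.Prime) (hq8 : q % 8 = 3) (hq7 : q % 7 = 3 ∨ q % 7 = 5 ∨ q % 7 = 6) (hm0 : 0 < m) (hmsq : Squarefree m)
  (hqm : ¬ q ∣ m) (hm : ∀ r : ℕ, r.Prime → r ∣ m → r % 4 = 1 ∧ (r % 7 = 3 ∨ r % 7 = 5 ∨ r % 7 = 6))
include hq hq8 hq7 hm0 hmsq hqm hm

/-- ★ **`S(21n, 112n²) ⊆ {1, 7}`** (`S^{(φ̂)}`, the descent on the divisors of `b = 112n²`) for `n = q m` in CELL-√7: a negative class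
dies over `ℝ` (`(21n)² < 4·112n²`), a class through a prime of `n` dies there (`(−7/r) = −1`), `2` and `14` die at `q`
(`(2/q) = (14/q) = −1`); `1 = δ(O)` and `7 ≡ 112 = δ(T)` remain. [cite: SilvermanAEC2009, Prop. X.4.9 and Example X.4.10] -/
theorem mem_twoIsogenySelmerGroup_phiHat {d : ℤ}
    (h : d ∈ twoIsogenySelmerGroup (21 * ((q * m : ℕ) : ℤ)) (112 * ((q * m : ℕ) : ℤ) ^ 2)) : d = 1 ∨ d = 7 := by
  haveI : Fact q.Prime := ⟨hq⟩
  obtain ⟨hnsq, h7n, hm4, hn0⟩ := cell_facts hq hq8 hm0 hmsq hqm hm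
  have hn0' : ((q * m : ℕ) : ℤ) ≠ 0 := by exact_mod_cast hn0.ne'
  have hb : (112 * ((q * m : ℕ) : ℤ) ^ 2 : ℤ) ≠ 0 := by positivity
  obtain ⟨hsq, hdvd, hloc⟩ := (mem_twoIsogenySelmerGroup_iff hb).mp h
  have hmul : d * (112 * ((q * m : ℕ) : ℤ) ^ 2 / d) = 112 * ((q * m : ℕ) : ℤ) ^ 2 := Int.mul_ediv_cancel' hdvd
  -- the real place: `d > 0`
  have hdpos : 0 < d := by
    by_contra hle
    have hd0 : d < 0 := lt_of_le_of_ne (not_lt.mp hle) hsq.ne_zero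
    refine not_isSoluble_real_twoIsogenyQuartic_of_neg_of_sq_lt hd0 ?_ hloc.1
    rw [hmul]; nlinarith [sq_nonneg (((q * m : ℕ) : ℤ)), sq_pos_of_ne_zero hn0']
  by_cases hodd : ∃ r : ℕ, r.Prime ∧ r ≠ 2 ∧ r ≠ 7 ∧ (r : ℤ) ∣ d
  · obtain ⟨r, hr, hr2, hr7, hrd⟩ := hodd
    exfalso
    haveI : Fact r.Prime := ⟨hr⟩
    have hrZ : Prime (r : ℤ) := Nat.prime_iff_prime_int.mp hr
    -- `r ∣ 112 n²` and `r ∤ 112` give `r ∣ n`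
    have hrn : r ∣ q * m := by
      rcases hrZ.dvd_or_dvd (hrd.trans hdvd) with h112 | hn2
      · exfalso
        have h' : r ∣ 2 ^ 4 * 7 := by exact_mod_cast h112
        rcases (Nat.Prime.dvd_mul hr).mp h' with h2 | h7
        · exact hr2 ((Nat.prime_dvd_prime_iff_eq hr Nat.prime_two).mp (hr.dvd_of_dvd_pow h2))
        · exact hr7 ((Nat.prime_dvd_prime_iff_eq hr (by norm_num)).mp h7)
      · exact_mod_cast hrZ.dvd_of_dvd_pow hn2
    have h7r : ¬ IsSquare ((-7 : ℤ) : ZMod r) := by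
      rcases (Nat.Prime.dvd_mul hr).mp hrn with hrq | hrm
      · obtain rfl := (Nat.prime_dvd_prime_iff_eq hr hq).mp hrq
        exact not_isSquare_neg_seven_of_mod_four_eq_three (by omega) hq7
      · exact (not_isSquare_seven_and_neg_seven_of_mod_four_eq_one (hm r hr hrm).1 (hm r hr hrm).2).2
    exact not_isSoluble_padic_phiHat_of_prime_dvd hnsq hrn h7r hsq hrd hdvd (hloc.2 r)
  · push Not at hodd
    have habs := natAbs_mem_of_squarefree hsq fun r hr hrd => by
      by_contra hne; push Not at hne; exact hodd r hr hne.1 hne.2 hrd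
    have hd' : d = 1 ∨ d = 2 ∨ d = 7 ∨ d = 14 := by omega
    rcases hd' with rfl | rfl | rfl | rfl
    · exact Or.inl rfl
    · exfalso
      have h2 := hloc.2 q
      rw [Int.ediv_eq_of_eq_mul_right (by norm_num)
        (show (112 * ((q * m : ℕ) : ℤ) ^ 2 : ℤ) = 2 * ((q : ℤ) ^ 2 * (56 * (m : ℤ) ^ 2)) by push_cast; ring)] at h2
      refine not_isSoluble_padic_of_nonresidue_of_sq_dvd (c := 21 * m) (by push_cast; ring) rfl
        (not_isSquare_two_mod_q hq8) ?_ h2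
      rw [show (56 * (m : ℤ) ^ 2 : ℤ) = 14 * (2 * m) ^ 2 by ring]
      exact not_isSquare_mul_sq (not_isSquare_fourteen hq8 hq7) fun h => by
        rcases (Nat.prime_iff_prime_int.mp hq).dvd_or_dvd h with h | h
        · have : q ∣ 2 := by exact_mod_cast h
          have := (Nat.prime_dvd_prime_iff_eq hq Nat.prime_two).mp this; omega
        · exact hqm (by exact_mod_cast h)
    · exact Or.inr rfl
    · exfalso
      have h2 := hloc.2 q
      rw [Int.ediv_eq_of_eq_mul_right (by norm_num)
        (show (112 * ((q * m : ℕ) : ℤ) ^ 2 : ℤ) = 14 * ((q : ℤ) ^ 2 * (8 * (m : ℤ) ^ 2)) by push_cast; ring)] at h2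
      refine not_isSoluble_padic_of_nonresidue_of_sq_dvd (c := 21 * m) (by push_cast; ring) rfl
        (not_isSquare_fourteen hq8 hq7) ?_ h2
      rw [show (8 * (m : ℤ) ^ 2 : ℤ) = 2 * (2 * m) ^ 2 by ring]
      exact not_isSquare_mul_sq (not_isSquare_two_mod_q hq8) fun h => by
        rcases (Nat.prime_iff_prime_int.mp hq).dvd_or_dvd h with h | h
        · have : q ∣ 2 := by exact_mod_cast h
          have := (Nat.prime_dvd_prime_iff_eq hq Nat.prime_two).mp this; omega
        · exact hqm (by exact_mod_cast h)

/-- ★ **`S(−42n, −7n²) ⊆ {1, −7}`** (`S^{(φ)}`, the descent on the divisors of `a² − 4b = −7n²`) for `n = q m` in CELL-√7: a class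
through a prime `r ∣ m` dies at `r` (`(7/r) = −1`); `−1, 7, q, −7q` die at `7` (`(−1/7) = (q/7) = −1`, `7 ∥ 7n²`); `−q, 7q` die at `2`
(residues modulo `32`); `1 = δ(O)` and `−7 = δ(T′)` remain. [cite: SilvermanAEC2009, Prop. X.4.9 and Example X.4.10] -/
theorem mem_twoIsogenySelmerGroup_phi {d : ℤ}
    (h : d ∈ twoIsogenySelmerGroup (-42 * ((q * m : ℕ) : ℤ)) (-7 * ((q * m : ℕ) : ℤ) ^ 2)) : d = 1 ∨ d = -7 := by
  haveI : Fact q.Prime := ⟨hq⟩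
  haveI : Fact (Nat.Prime 7) := ⟨by norm_num⟩
  obtain ⟨hnsq, h7n, hm4, hn0⟩ := cell_facts hq hq8 hm0 hmsq hqm hm
  have hq7' : q ≠ 7 := by rintro rfl; omega
  have hn0' : ((q * m : ℕ) : ℤ) ≠ 0 := by exact_mod_cast hn0.ne'
  have hb : (-7 * ((q * m : ℕ) : ℤ) ^ 2 : ℤ) ≠ 0 := by
    have : (0 : ℤ) < ((q * m : ℕ) : ℤ) ^ 2 := by positivity
    linarith
  have h7Z : Prime (7 : ℤ) := Int.prime_iff_natAbs_prime.mpr (by norm_num)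
  have h7nZ : ¬ (7 : ℤ) ∣ ((q * m : ℕ) : ℤ) := by exact_mod_cast h7n
  have h7n2 : ¬ (7 : ℤ) ∣ ((q * m : ℕ) : ℤ) ^ 2 := fun h => h7nZ (h7Z.dvd_of_dvd_pow h)
  have hq0 : (q : ℤ) ≠ 0 := by exact_mod_cast hq.ne_zero
  obtain ⟨hsq, hdvd, hloc⟩ := (mem_twoIsogenySelmerGroup_iff hb).mp h
  by_cases hodd : ∃ r : ℕ, r.Prime ∧ r ∣ m ∧ (r : ℤ) ∣ d
  · obtain ⟨r, hr, hrm, hrd⟩ := hodd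
    exfalso
    haveI : Fact r.Prime := ⟨hr⟩
    exact not_isSoluble_padic_phi_of_prime_dvd (by have := (hm r hr hrm).1; omega) hnsq (dvd_mul_of_dvd_right hrm q)
      (not_isSquare_seven_and_neg_seven_of_mod_four_eq_one (hm r hr hrm).1 (hm r hr hrm).2).1 hsq hrd hdvd (hloc.2 r)
  · push Not at hodd
    -- every prime factor of `d` is `7` or `q`
    have habs := natAbs_mem_of_squarefree_seven hq hq7' hsq fun r hr hrd => by
      have hrZ : Prime (r : ℤ) := Nat.prime_iff_prime_int.mp hr
      rcases hrZ.dvd_or_dvd (hrd.trans hdvd) with h7 | hn2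
      · left
        have h' : (r : ℤ) ∣ ((7 : ℕ) : ℤ) := by simpa using h7
        exact (Nat.prime_dvd_prime_iff_eq hr (by norm_num)).mp (Int.natCast_dvd_natCast.mp h')
      · have hrn : r ∣ q * m := by exact_mod_cast hrZ.dvd_of_dvd_pow hn2
        rcases (Nat.Prime.dvd_mul hr).mp hrn with hrq | hrm
        · exact Or.inr ((Nat.prime_dvd_prime_iff_eq hr hq).mp hrq)
        · exact absurd hrd (hodd r hr hrm)
    -- the eight sign classes `±1, ±7, ±q, ±7q`
    have hcases : d = 1 ∨ d = -1 ∨ d = 7 ∨ d = -7 ∨ d = q ∨ d = -(q : ℤ) ∨ d = 7 * q ∨ d = -(7 * (q : ℤ)) := by omega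
    have hcomm := fun (x y : ℤ) => isSoluble_map_twoIsogenyQuartic_comm (Int.castRingHom ℚ_[7]) (-42 * ((q * m : ℕ) : ℤ)) x y
    rcases hcases with rfl | rfl | rfl | rfl | rfl | rfl | rfl | rfl
    · exact Or.inl rfl
    · -- `−1` dies at `7`
      exfalso
      have h7 := hloc.2 7
      rw [show (-7 * ((q * m : ℕ) : ℤ) ^ 2 : ℤ) / -1 = 7 * ((q * m : ℕ) : ℤ) ^ 2 by rw [Int.ediv_neg, Int.ediv_one]; ring] at h7
      exact not_isSoluble_padic_of_nonresidue_of_prime_dvd (p := 7) (c := -6 * ((q * m : ℕ) : ℤ)) (e' := ((q * m : ℕ) : ℤ) ^ 2)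
        (by push_cast; ring) (by push_cast; ring) h7n2
        (by rintro ⟨r, hr⟩; push_cast at hr; exact (zmod_seven_nonresidues r).2.2.2 hr.symm) h7
    · -- `7` dies at `7` (chart swap)
      exfalso
      have h7 := hloc.2 7
      rw [Int.ediv_eq_of_eq_mul_right (by norm_num)
        (show (-7 * ((q * m : ℕ) : ℤ) ^ 2 : ℤ) = 7 * (-(((q * m : ℕ) : ℤ) ^ 2)) by ring), hcomm] at h7
      exact not_isSoluble_padic_of_nonresidue_of_prime_dvd (p := 7) (c := -6 * ((q * m : ℕ) : ℤ)) (e' := 1)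
        (by push_cast; ring) (by norm_num) (by norm_num) (not_isSquare_neg_sq_zmod_seven h7nZ) h7
    · exact Or.inr rfl
    · -- `q` dies at `7`
      exfalso
      have h7 := hloc.2 7
      rw [Int.ediv_eq_of_eq_mul_right hq0
        (show (-7 * ((q * m : ℕ) : ℤ) ^ 2 : ℤ) = q * (7 * (-((q : ℤ) * (m : ℤ) ^ 2))) by push_cast; ring)] at h7
      refine not_isSoluble_padic_of_nonresidue_of_prime_dvd (p := 7) (c := -6 * ((q * m : ℕ) : ℤ)) (e' := -((q : ℤ) * (m : ℤ) ^ 2))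
        (by push_cast; ring) (by push_cast; ring) ?_ (not_isSquare_zmod_seven hq7) h7
      rw [dvd_neg]
      intro h
      apply h7nZ
      push_cast
      rcases h7Z.dvd_or_dvd h with h1 | h2
      · exact dvd_mul_of_dvd_left h1 _
      · exact dvd_mul_of_dvd_right (h7Z.dvd_of_dvd_pow h2) _
    · -- `−q` dies at `2`
      exfalso
      have h2 := hloc.2 2
      rw [Int.ediv_eq_of_eq_mul_right (neg_ne_zero.mpr hq0)
        (show (-7 * ((q * m : ℕ) : ℤ) ^ 2 : ℤ) = -(q : ℤ) * (7 * q * (m : ℤ) ^ 2) by push_cast; ring)] at h2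
      exact not_isSoluble_two_neg_q hq8 hm4 h2
    · -- `7q` dies at `2`
      exfalso
      have h2 := hloc.2 2
      rw [Int.ediv_eq_of_eq_mul_right (mul_ne_zero (by norm_num) hq0)
        (show (-7 * ((q * m : ℕ) : ℤ) ^ 2 : ℤ) = 7 * (q : ℤ) * (-((q : ℤ) * (m : ℤ) ^ 2)) by push_cast; ring)] at h2
      exact not_isSoluble_two_seven_q hq8 hm4 h2
    · -- `−7q` dies at `7` (chart swap)
      exfalso
      have h7 := hloc.2 7
      rw [Int.ediv_eq_of_eq_mul_right (neg_ne_zero.mpr (mul_ne_zero (by norm_num) hq0))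
        (show (-7 * ((q * m : ℕ) : ℤ) ^ 2 : ℤ) = -(7 * (q : ℤ)) * ((q : ℤ) * (m : ℤ) ^ 2) by push_cast; ring), hcomm] at h7
      refine not_isSoluble_padic_of_nonresidue_of_prime_dvd (p := 7) (c := -6 * ((q * m : ℕ) : ℤ)) (e' := -(q : ℤ))
        (by push_cast; ring) (by push_cast; ring) ?_ (not_isSquare_mul_sq_zmod_seven hq7 fun h7m => ?_) h7
      · rw [dvd_neg]
        intro h
        have : 7 ∣ q := by exact_mod_cast h
        exact hq7' ((Nat.prime_dvd_prime_iff_eq (by norm_num) hq).mp this).symm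
      · have : 7 ∣ m := by exact_mod_cast h7m
        have := (hm 7 (by norm_num) this).2; omega

/-- `#S(21n, 112n²) ≤ 2` on the cell. [cite: SilvermanAEC2009, Prop. X.4.9] -/
theorem card_twoIsogenySelmerGroup_le :
    (twoIsogenySelmerGroup (21 * ((q * m : ℕ) : ℤ)) (112 * ((q * m : ℕ) : ℤ) ^ 2)).card ≤ 2 :=
  le_trans (Finset.card_le_card fun d hd => by
    have := mem_twoIsogenySelmerGroup_phiHat hq hq8 hq7 hm0 hmsq hqm hm hd
    simp only [Finset.mem_insert, Finset.mem_singleton]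
    exact this) (Finset.card_le_two (a := (1 : ℤ)) (b := 7))

/-- `#S′(21n, 112n²) = #S(−42n, −7n²) ≤ 2` on the cell. [cite: SilvermanAEC2009, Prop. X.4.9] -/
theorem card_twoIsogenySelmerGroup'_le :
    (twoIsogenySelmerGroup' (21 * ((q * m : ℕ) : ℤ)) (112 * ((q * m : ℕ) : ℤ) ^ 2)).card ≤ 2 := by
  rw [twoIsogenySelmerGroup'_A]
  exact le_trans (Finset.card_le_card fun d hd => by
    have := mem_twoIsogenySelmerGroup_phi hq hq8 hq7 hm0 hmsq hqm hm hd
    simp only [Finset.mem_insert, Finset.mem_singleton]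
    exact this) (Finset.card_le_two (a := (1 : ℤ)) (b := -7))

end Selmer

/-! ## §4 `rank A_n(ℚ) = 0`, `Ш(A_n/ℚ)[2] = 0`, `corank_{ℤ₂} Sel_{2^∞}(A_n/ℚ) = 0` -/

section RankZero

/-- The tree's cast literal `E_{21n, 112n²}` is `A_n = ⟨0, 21n, 0, 112n², 0⟩`. [folklore] -/
theorem lit_A (n : ℕ) :
    (⟨0, ((21 * (n : ℤ) : ℤ) : ℚ), 0, ((112 * (n : ℤ) ^ 2 : ℤ) : ℚ), 0⟩ : WeierstrassCurve ℚ) =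
      ⟨0, 21 * (n : ℚ), 0, 112 * (n : ℚ) ^ 2, 0⟩ := by
  ext <;> push_cast <;> rfl

/-- `A_n` is an elliptic curve for `n ≠ 0` (`Δ = −2¹²·7³·n⁶`). [cite: SilvermanAEC2009, Prop. X.4.9] -/
theorem isElliptic_A {n : ℕ} (hn : n ≠ 0) : (⟨0, 21 * (n : ℚ), 0, 112 * (n : ℚ) ^ 2, 0⟩ : WeierstrassCurve ℚ).IsElliptic := by
  rw [← lit_A]
  exact isElliptic_mk_of_ne_zero (F := ℚ) (hab_posTwist (M := (n : ℤ)) (by exact_mod_cast hn))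

variable {q m : ℕ} (hq : q.Prime) (hq8 : q % 8 = 3) (hq7 : q % 7 = 3 ∨ q % 7 = 5 ∨ q % 7 = 6) (hm0 : 0 < m)
  (hmsq : Squarefree m) (hqm : ¬ q ∣ m) (hm : ∀ r : ℕ, r.Prime → r ∣ m → r % 4 = 1 ∧ (r % 7 = 3 ∨ r % 7 = 5 ∨ r % 7 = 6))
include hq hq8 hq7 hm0 hmsq hqm hm

/-- ★ **CELL-√7: `rank A_n(ℚ) = 0` and `Ш(A_n/ℚ)[2] = 0`** for `A_n : y² = x³ + 21n x² + 112n² x`, `n = q m`, `q ≡ 3 (mod 8)` a prime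
inert in `ℚ(√−7)`, `m ≥ 1` square-free prime to `q` with every prime factor `≡ 1 (mod 4)` and inert in `ℚ(√−7)` — UNCONDITIONAL: the
counted Kummer sequences `#S·#S′ = 2^{rank+2}·#Ш(A′)[φ̂]·#Ш(A)[φ]` (`two_pow_twoIsogenySelmerRank_add_eq`, AEC X.4.2(a)) with `#S, #S′ ≤ 2`
force `rank = 0` and both `φ`-parts trivial, whence `Ш[2] = 0` (`forall_mem_sha_two_smul_eq_zero_of_halfModel`, AEC III.6.1).
[cite: SilvermanAEC2009, Thm. X.4.2(a), Prop. X.4.9, Example X.4.10] -/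
theorem rank_eq_zero_and_sha_two :
    (⟨0, 21 * ((q * m : ℕ) : ℚ), 0, 112 * ((q * m : ℕ) : ℚ) ^ 2, 0⟩ : WeierstrassCurve ℚ).mordellWeilRank = 0 ∧
      ∀ c ∈ (⟨0, 21 * ((q * m : ℕ) : ℚ), 0, 112 * ((q * m : ℕ) : ℚ) ^ 2, 0⟩ : WeierstrassCurve ℚ).sha, 2 • c = 0 → c = 0 := by
  have hn0 : (q * m : ℕ) ≠ 0 := Nat.mul_ne_zero hq.ne_zero hm0.ne'
  have hab := hab_posTwist (M := ((q * m : ℕ) : ℤ)) (by exact_mod_cast hn0)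
  haveI := isElliptic_halfModel hab
  haveI := isElliptic_mk_of_ne_zero (F := ℚ) hab
  haveI := isElliptic_A hn0
  have h := rank_eq_zero_and_sha_two_of_card_le_two hab (card_twoIsogenySelmerGroup_le hq hq8 hq7 hm0 hmsq hqm hm)
    (card_twoIsogenySelmerGroup'_le hq hq8 hq7 hm0 hmsq hqm hm)
  refine ⟨?_, forall_mem_sha_two_congr (lit_A (q * m)).symm h.2⟩
  rw [← mordellWeilRank_congr (lit_A (q * m))]
  exact h.1

/-- ★ **CELL-√7, corank form: `corank_{ℤ₂} Sel_{2^∞}(A_n/ℚ) = 0`** (`corank Sel = rank + corank Ш[2^∞]`, Greenberg, tree theorem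
`selmerCorank_eq_mordellWeilRank_add_holds`; `rank = 0` and `Ш[2] = 0`). This is the hypothesis of Burungale–Tian's rank-zero `2`-converse.
[cite: SilvermanAEC2009, Thm. X.4.2(a) and Prop. X.4.9] [cite: Greenberg1999, §1] -/
theorem selmerCorank_two_eq_zero
    [hE : (⟨0, 21 * ((q * m : ℕ) : ℚ), 0, 112 * ((q * m : ℕ) : ℚ) ^ 2, 0⟩ : WeierstrassCurve ℚ).IsElliptic] :
    (⟨0, 21 * ((q * m : ℕ) : ℚ), 0, 112 * ((q * m : ℕ) : ℚ) ^ 2, 0⟩ : WeierstrassCurve ℚ).selmerCorank 2 = 0 := by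
  haveI : Fact (Nat.Prime 2) := ⟨Nat.prime_two⟩
  obtain ⟨hr, hsha⟩ := rank_eq_zero_and_sha_two hq hq8 hq7 hm0 hmsq hqm hm
  rw [(⟨0, 21 * ((q * m : ℕ) : ℚ), 0, 112 * ((q * m : ℕ) : ℚ) ^ 2, 0⟩ : WeierstrassCurve ℚ).selmerCorank_eq_mordellWeilRank_add_holds 2,
    hr, (⟨0, 21 * ((q * m : ℕ) : ℚ), 0, 112 * ((q * m : ℕ) : ℚ) ^ 2, 0⟩ : WeierstrassCurve ℚ).shaCorank_eq_zero_of_forall 2 hsha]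

end RankZero

end Summit.BirchSwinnertonDyer.BirchSwinnertonDyer.Theorems.BiquadraticEisensteinDescentHeegnerTwistCouplingInSupplySqrtSevenCell

end
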